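import Literature.NumberTheory.Automorphic.ShimuraCurveHeckeOperatorProofs
import Literature.NumberTheory.Automorphic.ShimuraCurveIdealCountBridge
import HarnessLib

/-!
# `T_{D,M,mn} = T_{D,M,m} T_{D,M,n}` and `T_{D,M,m} T_{D,M,n} = T_{D,M,n} T_{D,M,m}` for coprime
# `m, n` on `S₂^D(M)` (`D > 1`): Eichler's unique factorisation in the Eichler order of `X₀^D(M)`

A proofs-only companion (theorems only: no definition, no named fact, nothing restated; D-0026) of
`ShimuraCurve.lean` / `ShimuraCurveRibetTakahashi.lean`, written by the seat of the named fact
`Literature.NumberTheory.Automorphic.nonempty_shimuraParametrizationData` (the Jacquet–Langlands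
parametrisation `X₀^D(M) → A_{D,M} ∼ E`, Pasten 2024 §2 p. 12). That fact is reduced in the tree to
the Modularity theorem and, for `D > 1`, to the Jacquet–Langlands transfer (T) and Shimura's
construction (S₁) (`ShimuraParametrizationIsogenyProofs`); the present file continues the
infrastructure below (T) — after `T_n ∈ End S₂^D(M)` (`ShimuraCurveHeckeOperatorProofs`),
`dim S₂^D(M) < ∞` (`ShimuraCurveCuspFormsFiniteDimensionalProofs`) and the self-adjointness of the
`T_n` (`ShimuraCurveHeckeSelfAdjointProofs`) — with the next printed brick of Pasten §4.8–4.9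
p. 15: the Hecke operators `T_{D,M,n}` of a Shimura curve datum `X : ShimuraCurveData D M` compose
multiplicatively on coprime indices and therefore **commute** (§4.9: "`T_{D,M}` … the (commutative)
algebra generated by the `T_{D,M,n}`"), which with self-adjointness gives the simultaneous
eigen-decomposition of `S₂^D(M)` (§4.9: "simultaneously diagonalizable"; carried out in
`ShimuraCurveHeckeSimultaneousEigenformsProofs`).

## Contents

1. **Unique factorisation in `O` for coprime norms** (Eichler, LNM 320, II §6 Thm. 2, in
   elementwise form for the indefinite order, where every invertible ideal is principal):
   `ShimuraCurveData.exists_mul_eq_of_nrdZ_eq_mul` — for `D > 1` every `c ∈ O` with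
   `nrd c = n₁ n₂`, `gcd(n₁, n₂) = 1`, factors as `c = a b`, `a, b ∈ O`, `nrd a = n₁`, `nrd b = n₂`
   (the right ideal `c O + n₁ O` is invertible by the tree's global lemma
   `IsInvertibleRightIdeal.sup_smul`, hence principal with a positive-norm generator by Eichler's
   theorem `ShimuraCurveData.exists_eq_units_smul_of_pos`, and the norm of the generator is pinned
   to `n₁` by three divisibilities); `ShimuraCurveData.exists_unit_of_mul_eq_mul` — uniqueness up to
   `O¹` (Bezout; any `D`).
2. **Cosets**: `ι(O(n₁)) ι(O(n₂)) ⊆ ι(O(n₁ n₂))` (`mul_mem_heckeSet_mul`) and the map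
   `(Γα, Γβ) ↦ Γ α β_out` from `Γ\ι(O(n₁)) × Γ\ι(O(n₂))` to `Γ\ι(O(n₁ n₂))` is a bijection
   (`exists_mk_out_mul_out_eq`, `eq_of_mk_out_mul_out_eq`); dictionary lemmas between `ι(O(n))`,
   `Γ` and elements of `O` (`exists_mem_O_ι_eq_of_mem_heckeSet`, `exists_heckeSet_coe_eq_ι`,
   `exists_mem_O_ι_eq_of_mem_Gamma`, `exists_mem_Gamma_coe_eq_ι_of_nrdZ_eq_one`).
3. **`T_{n₂} (T_{n₁} h) = T_{n₁ n₂} h`** for `Γ`-invariant `h` of weight `2` and coprime `n₁, n₂`,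
   `D > 1` (`ShimuraCurveData.heckeFun_heckeFun_of_coprime`; Mathlib's slash action, the tree's
   `ShimuraCurveData.heckeFun`), hence **`T_{n₁} T_{n₂} = T_{n₂} T_{n₁}`**
   (`ShimuraCurveData.heckeFun_comm_of_coprime`).
4. The same for the endomorphisms of `S₂^D(M) = CuspForm X.Gamma 2` of
   `exists_linearMap_coe_eq_heckeFun`: `linearMap_comp_eq_of_coprime`, `commute_linearMap_of_coprime`.

No coprimality of the indices with the level `D M` is needed: the operators are those of the tree
(`X.heckeFun n`, sums over `Γ \ ι(O(n))` for ALL `n`), and Eichler's theorem holds for every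
invertible ideal of the Eichler order.

## References

* H. Pasten, *Shimura curves and the abc conjecture*, J. Number Theory 254 (2024), §4.8–4.9 p. 15
  [PastenShimura2024].
* M. Eichler, *The basis problem for modular forms and the traces of the Hecke operators*, LNM 320
  (1973), Ch. II §6 Thm. 2 (18), (23) [Eichler1973].
* G. Shimura, *Introduction to the arithmetic theory of automorphic functions* (1971), §3.3
  Thm. 3.24, §3.4 Thm. 3.34 [ShimuraIATAF1971].
* M.-F. Vignéras, *Arithmétique des algèbres de quaternions*, LNM 800 (1980), Ch. III §5 Cor. 5.7
  [VignerasLNM800].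
-/

noncomputable section

open UpperHalfPlane
open scoped Pointwise MatrixGroups ModularForm Manifold ComplexConjugate
open MeasureTheory

namespace Literature.NumberTheory.Automorphic

namespace ShimuraCurveData

variable {D M : ℕ} (X : ShimuraCurveData D M)

/-! ### 1. Unique factorisation of elements of coprime norm in the Eichler order -/

/-- `nrdZ` of a natural number `n ∈ O` is `n²`. [folklore] -/
theorem nrdZ_natCast (n : ℕ) : nrdZ ((n : X.B)) = (n : ℤ) ^ 2 := by
  have hZ := X.isZOrder
  have hn : ((n : X.B)) ∈ X.O := by
    simpa using X.O.smul_mem (n : ℤ) hZ.one_mem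
  have h : (nrdZ (n : X.B) : ℚ) = ((n : ℤ) ^ 2 : ℤ) := by
    rw [hZ.cast_nrdZ hn, show ((n : X.B)) = algebraMap ℚ X.B (n : ℚ) by simp,
      reducedNorm_algebraMap]
    push_cast
    ring
  exact_mod_cast h

/-- **Uniqueness of the factorisation up to `O¹`.** If `a b = a' b'` in `O` with `nrd a' = n₁`,
`nrd b = nrd b' = n₂`, `gcd(n₁, n₂) = 1` and `n₂ ≠ 0`, then `b' = u b` and `a = a' u` for a unit
`u ∈ O` of reduced norm `1` (Bezout: `b' = s ā' a b + t b' b̄ b`). Any quaternion order; this is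
the uniqueness half of Eichler's unique factorisation of integral ideals of coprime norms
(LNM 320, II §6 Thm. 2) in elementwise form. [cite: Eichler1973, Ch. II §6 Thm. 2] -/
theorem exists_unit_of_mul_eq_mul {a a' b b' : X.B} (ha : a ∈ X.O) (ha' : a' ∈ X.O)
    (hb : b ∈ X.O) (hb' : b' ∈ X.O) {n₁ n₂ : ℕ} (hcop : n₁.Coprime n₂) (hn₂ : n₂ ≠ 0)
    (hna' : nrdZ a' = n₁) (hnb : nrdZ b = n₂) (hnb' : nrdZ b' = n₂)
    (heq : a * b = a' * b') :
    ∃ u ∈ X.O, nrdZ u = 1 ∧ u * b = b' ∧ a' * u = a := by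
  haveI := X.charZero_B
  have hZ := X.isZOrder
  obtain ⟨s, t, hst⟩ := Nat.isCoprime_iff_coprime.mpr hcop
  set u : X.B := s • (standardInvolution ℚ X.B a' * a) + t • (b' * standardInvolution ℚ X.B b) with hu
  have huO : u ∈ X.O :=
    X.O.add_mem (X.O.smul_mem s (hZ.mul_mem _ (hZ.standardInvolution_mem ha') _ ha))
      (X.O.smul_mem t (hZ.mul_mem _ hb' _ (hZ.standardInvolution_mem hb)))
  have hub : u * b = b' := by
    have h1 : standardInvolution ℚ X.B a' * a * b = (n₁ : ℤ) • b' := by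
      rw [mul_assoc, heq, ← mul_assoc, hZ.standardInvolution_mul_eq ha', hna', smul_mul_assoc, one_mul]
    have h2 : b' * standardInvolution ℚ X.B b * b = (n₂ : ℤ) • b' := by
      rw [mul_assoc, hZ.standardInvolution_mul_eq hb, hnb, mul_smul_comm, mul_one]
    rw [hu, add_mul, smul_mul_assoc, smul_mul_assoc, h1, h2, smul_smul, smul_smul, ← add_smul,
      hst, one_smul]
  have hnu : nrdZ u = 1 := by
    have h := hZ.nrdZ_mul huO hb
    rw [hub, hnb', hnb] at h
    have hn₂' : (n₂ : ℤ) ≠ 0 := by exact_mod_cast hn₂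
    have : (n₂ : ℤ) * 1 = (n₂ : ℤ) * nrdZ u := by rw [mul_one, mul_comm]; exact h
    exact (mul_left_cancel₀ hn₂' this).symm
  refine ⟨u, huO, hnu, hub, ?_⟩
  -- `a' u b = a' b' = a b`, and `b` is a unit
  have hbunit : IsUnit b := by
    refine IsQuaternionAlgebra.isUnit_of_reducedNorm_ne_zero (K := ℚ) ?_
    rw [← hZ.cast_nrdZ hb, hnb]
    exact_mod_cast hn₂
  obtain ⟨w, hw⟩ := hbunit
  have h : (a' * u) * b = a * b := by rw [mul_assoc, hub, heq]
  rw [← hw] at h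
  exact (Units.mul_left_inj w).mp h

/-- **Existence of the factorisation (`D > 1`).** Every `c ∈ O` with `nrd c = n₁ n₂`,
`gcd(n₁, n₂) = 1`, `n₁, n₂ ≥ 1`, factors as `c = a b` with `a, b ∈ O`, `nrd a = n₁`, `nrd b = n₂`:
the right ideal `K = c O + n₁ O` is invertible (`IsInvertibleRightIdeal.sup_smul`, as
`n₁ n₂ O = c c̄ O ⊆ c O`), hence principal, `K = a O` with `nrd a > 0`, by Eichler's theorem for
the Eichler order of `X₀^D(M)` (`exists_eq_units_smul_of_pos`); then `c = a b`, and `nrd a = n₁`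
because `n₁ ∣ nrd a` (`a ∈ c O + n₁ O`, polarisation), `nrd a ∣ n₁²` (`n₁ ∈ a O`) and
`nrd a ∣ n₁ n₂` (`c ∈ a O`). The existence half of Eichler's unique factorisation (LNM 320, II §6
Thm. 2 (18), (23)) for principal ideals of the indefinite order. [cite: Eichler1973, Ch. II §6 Thm. 2] [cite: VignerasLNM800, Ch. III §5 Cor. 5.7] -/
theorem exists_mul_eq_of_nrdZ_eq_mul (hD : 1 < D) (hM : 0 < M) {c : X.B} (hc : c ∈ X.O)
    {n₁ n₂ : ℕ} (hn₁ : 0 < n₁) (hn₂ : 0 < n₂) (hcop : n₁.Coprime n₂)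
    (hnrd : nrdZ c = n₁ * n₂) :
    ∃ a ∈ X.O, ∃ b ∈ X.O, a * b = c ∧ nrdZ a = n₁ ∧ nrdZ b = n₂ := by
  classical
  haveI := X.nontrivial_B
  haveI := X.charZero_B
  have hZ := X.isZOrder
  have hc0 : c ≠ 0 := by
    rintro rfl
    have h : (nrdZ (0 : X.B) : ℚ) = 0 := by rw [hZ.cast_nrdZ X.O.zero_mem, reducedNorm_apply_zero]
    rw [hnrd] at h
    have : (n₁ : ℚ) * n₂ = 0 := by exact_mod_cast h
    rcases mul_eq_zero.mp this with h | h
    · exact hn₁.ne' (by exact_mod_cast h)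
    · exact hn₂.ne' (by exact_mod_cast h)
  set u : (X.B)ˣ := (X.isUnit_of_ne_zero hD c hc0).unit with hudef
  have hu : (u : X.B) = c := (X.isUnit_of_ne_zero hD c hc0).unit_spec
  -- the right ideal `K = c O + n₁ O`
  have hMinv : IsInvertibleRightIdeal X.O (u • X.O) := hZ.isInvertibleRightIdeal_self.units_smul u
  have hMI : u • X.O ≤ X.O := by
    refine (Brandt.units_smul_le_iff_mem_leftOrder X.O u).mpr ?_
    rw [hZ.toIsOrder.leftOrder_eq, hu]
    exact hc
  obtain ⟨s, t, hst⟩ := Nat.isCoprime_iff_coprime.mpr hcop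
  have hcd : ((n₁ : ℤ) * (n₂ : ℤ)) • X.O ≤ u • X.O := by
    intro z hz
    obtain ⟨x, hx, rfl⟩ := (Submodule.mem_smul_pointwise_iff_exists z _ X.O).mp hz
    refine (Submodule.mem_smul_pointwise_iff_exists _ _ _).mpr
      ⟨standardInvolution ℚ X.B c * x, hZ.mul_mem _ (hZ.standardInvolution_mem hc) _ hx, ?_⟩
    rw [Units.smul_def, hu, smul_eq_mul, ← mul_assoc, hZ.mul_standardInvolution_eq hc, hnrd,
      smul_mul_assoc, one_mul]
  have hK : IsInvertibleRightIdeal X.O (u • X.O ⊔ ((n₁ : ℤ)) • X.O) :=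
    hMinv.sup_smul hZ.isInvertibleRightIdeal_self hMI hst hcd
  have hKO : u • X.O ⊔ ((n₁ : ℤ)) • X.O ≤ X.O := by
    refine sup_le hMI fun z hz => ?_
    obtain ⟨x, hx, rfl⟩ := (Submodule.mem_smul_pointwise_iff_exists z _ X.O).mp hz
    exact X.O.smul_mem _ hx
  obtain ⟨β, hβO, hβpos, hKβ⟩ := X.exists_eq_units_smul_of_pos hD hM hK hKO
  -- memberships
  have hcK : c ∈ (β • X.O : Submodule ℤ X.B) := by
    rw [← hKβ]
    refine Submodule.mem_sup_left ((Submodule.mem_smul_pointwise_iff_exists _ _ _).mpr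
      ⟨1, hZ.one_mem, ?_⟩)
    rw [Units.smul_def, hu, smul_eq_mul, mul_one]
  have hn₁K : ((n₁ : ℤ) • (1 : X.B)) ∈ (β • X.O : Submodule ℤ X.B) := by
    rw [← hKβ]
    exact Submodule.mem_sup_right (Submodule.smul_mem_pointwise_smul _ _ _ hZ.one_mem)
  have hβK : (β : X.B) ∈ u • X.O ⊔ ((n₁ : ℤ)) • X.O := by
    rw [hKβ]
    exact (Submodule.mem_smul_pointwise_iff_exists _ _ _).mpr
      ⟨1, hZ.one_mem, by rw [Units.smul_def, smul_eq_mul, mul_one]⟩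
  obtain ⟨b, hb, hbc⟩ := (Submodule.mem_smul_pointwise_iff_exists _ _ _).mp hcK
  obtain ⟨e, he, hen⟩ := (Submodule.mem_smul_pointwise_iff_exists _ _ _).mp hn₁K
  rw [Units.smul_def, smul_eq_mul] at hbc hen
  obtain ⟨z₁, hz₁, z₂, hz₂, hz⟩ := Submodule.mem_sup.mp hβK
  obtain ⟨x, hx, rfl⟩ := (Submodule.mem_smul_pointwise_iff_exists z₁ _ X.O).mp hz₁
  obtain ⟨y, hy, rfl⟩ := (Submodule.mem_smul_pointwise_iff_exists z₂ _ X.O).mp hz₂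
  rw [Units.smul_def, hu, smul_eq_mul] at hz
  -- norms
  have h1 : nrdZ (β : X.B) * nrdZ b = n₁ * n₂ := by rw [← hZ.nrdZ_mul hβO hb, hbc, hnrd]
  have h2 : nrdZ (β : X.B) * nrdZ e = n₁ ^ 2 := by
    rw [← hZ.nrdZ_mul hβO he, hen]
    have : ((n₁ : ℤ) • (1 : X.B)) = ((n₁ : ℕ) : X.B) := by simp
    rw [this, X.nrdZ_natCast]
  have h3 : (n₁ : ℤ) ∣ nrdZ (β : X.B) := by
    -- polarisation: `nrd(c x + n₁ y) = n₁ n₂ nrd x + n₁² nrd y + n₁ trd(c x ȳ)`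
    have hcx : c * x ∈ X.O := hZ.mul_mem _ hc _ hx
    have hq : (nrdZ (β : X.B) : ℚ) =
        n₁ * (n₂ * nrdZ x + n₁ * nrdZ y + trdZ (c * x * standardInvolution ℚ X.B y)) := by
      rw [hZ.cast_nrdZ hβO, ← hz, reducedNorm_add, ← Int.cast_smul_eq_zsmul ℚ, standardInvolution_smul,
        mul_smul_comm, map_smul, reducedNorm_smul, reducedNorm_mul_holds ℚ X.B c x,
        ← hZ.cast_nrdZ hc, ← hZ.cast_nrdZ hx, ← hZ.cast_nrdZ hy,
        ← hZ.cast_trdZ (hZ.mul_mem _ hcx _ (hZ.standardInvolution_mem hy)), hnrd, smul_eq_mul]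
      push_cast
      ring
    have hq' : nrdZ (β : X.B) =
        n₁ * (n₂ * nrdZ x + n₁ * nrdZ y + trdZ (c * x * standardInvolution ℚ X.B y)) := by
      exact_mod_cast hq
    exact ⟨_, hq'⟩
  have hβpos' : 0 < nrdZ (β : X.B) := by
    have : (0 : ℚ) < nrdZ (β : X.B) := by rw [hZ.cast_nrdZ hβO]; exact hβpos
    exact_mod_cast this
  -- `nrd β = n₁`
  obtain ⟨k, hk⟩ := h3
  have hn₁' : (n₁ : ℤ) ≠ 0 := by exact_mod_cast hn₁.ne'
  have hk1 : k ∣ (n₁ : ℤ) := by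
    refine ⟨nrdZ e, mul_left_cancel₀ hn₁' ?_⟩
    rw [← mul_assoc, ← hk, h2, sq]
  have hk2 : k ∣ (n₂ : ℤ) := by
    refine ⟨nrdZ b, mul_left_cancel₀ hn₁' ?_⟩
    rw [← mul_assoc, ← hk, h1]
  have hkunit : IsUnit k := by
    obtain ⟨k₁, hk₁⟩ := hk1
    obtain ⟨k₂, hk₂⟩ := hk2
    refine isUnit_of_dvd_one ⟨s * k₁ + t * k₂, ?_⟩
    rw [← hst, hk₁, hk₂]
    ring
  have hkone : k = 1 := by
    rcases Int.isUnit_iff.mp hkunit with rfl | rfl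
    · rfl
    · exfalso
      rw [mul_neg, mul_one] at hk
      have : (0 : ℤ) < n₁ := by exact_mod_cast hn₁
      omega
  rw [hkone, mul_one] at hk
  refine ⟨β, hβO, b, hb, hbc, hk, ?_⟩
  rw [hk] at h1
  exact mul_left_cancel₀ hn₁' h1


/-! ### 2. `ι(O(n₁)) · ι(O(n₂)) ⊆ ι(O(n₁ n₂))` and the coset spaces -/

/-- An element of `ι(O(n))` is `ι(x)` with `x ∈ O`, `nrd x = n`. [folklore] -/
theorem exists_mem_O_ι_eq_of_mem_heckeSet {n : ℕ} {g : GL (Fin 2) ℝ} (hg : g ∈ X.heckeSet n) :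
    ∃ x ∈ X.O, X.ι x = (g : Matrix (Fin 2) (Fin 2) ℝ) ∧ nrdZ x = n := by
  have hZ := X.isZOrder
  obtain ⟨⟨x, hx, hxg⟩, hdet⟩ := hg
  refine ⟨x, hx, hxg, ?_⟩
  have h1 : ((nrdZ x : ℚ) : ℝ) = (n : ℝ) := by
    rw [hZ.cast_nrdZ hx, ← (X.trace_ι_eq_and_det_ι_eq x).2, hxg, hdet]
  exact_mod_cast h1

/-- For `x ∈ O` with `nrd x = n ≥ 1`, the matrix `ι(x)` packaged as an element of `ι(O(n))`.
[folklore] -/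
theorem exists_heckeSet_coe_eq_ι {x : X.B} (hx : x ∈ X.O) {n : ℕ} (hn : 0 < n) (hxn : nrdZ x = n) :
    ∃ g : X.heckeSet n, ((g : GL (Fin 2) ℝ) : Matrix (Fin 2) (Fin 2) ℝ) = X.ι x := by
  have hZ := X.isZOrder
  have hdet : (X.ι x).det = n := by
    rw [(X.trace_ι_eq_and_det_ι_eq x).2, ← hZ.cast_nrdZ hx, hxn]
    push_cast
    rfl
  exact ⟨⟨Matrix.GeneralLinearGroup.mkOfDetNeZero (X.ι x)
    (by rw [hdet]; exact_mod_cast hn.ne'), ⟨x, hx, rfl⟩, hdet⟩, rfl⟩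

/-- An element of `Γ = ι(O¹)` is `ι(u)` with `u ∈ O`, `nrd u = 1`. [folklore] -/
theorem exists_mem_O_ι_eq_of_mem_Gamma {γ : GL (Fin 2) ℝ} (hγ : γ ∈ X.Gamma) :
    ∃ u ∈ X.O, X.ι u = (γ : Matrix (Fin 2) (Fin 2) ℝ) ∧ nrdZ u = 1 := by
  have hγ' : γ ∈ X.heckeSet 1 := by
    refine ⟨hγ.1, ?_⟩
    rw [← Matrix.GeneralLinearGroup.val_det_apply, Subgroup.HasDetOne.det_eq hγ, Units.val_one,
      Nat.cast_one]
  obtain ⟨u, hu, huγ, hn⟩ := X.exists_mem_O_ι_eq_of_mem_heckeSet hγ'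
  exact ⟨u, hu, huγ, by exact_mod_cast hn⟩

/-- A unit `u ∈ O` of reduced norm `1` gives an element `ι(u) ∈ Γ` (its inverse is `ū ∈ O`).
[folklore] -/
theorem exists_mem_Gamma_coe_eq_ι_of_nrdZ_eq_one {u : X.B} (hu : u ∈ X.O) (hN : nrdZ u = 1) :
    ∃ γ ∈ X.Gamma, (γ : Matrix (Fin 2) (Fin 2) ℝ) = X.ι u :=
  X.exists_mem_Gamma_coe_eq_ι hu (X.isZOrder.standardInvolution_mem hu)
    (by rw [X.isZOrder.standardInvolution_mul_eq hu, hN, one_smul]) hN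

/-- `ι(O(n₁)) ι(O(n₂)) ⊆ ι(O(n₁ n₂))`. [folklore] -/
theorem mul_mem_heckeSet_mul {n₁ n₂ : ℕ} {a b : GL (Fin 2) ℝ} (ha : a ∈ X.heckeSet n₁)
    (hb : b ∈ X.heckeSet n₂) : a * b ∈ X.heckeSet (n₁ * n₂) := by
  obtain ⟨⟨x, hx, hxa⟩, hdeta⟩ := ha
  obtain ⟨⟨y, hy, hyb⟩, hdetb⟩ := hb
  refine ⟨⟨x * y, X.isOrder.mul_mem _ hx _ hy, by rw [map_mul, hxa, hyb, Units.val_mul]⟩, ?_⟩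
  rw [Units.val_mul, Matrix.det_mul, hdeta, hdetb, Nat.cast_mul]

/-- **Surjectivity of `(Γα, Γβ) ↦ Γ α β_out`** (`D > 1`, `gcd(n₁, n₂) = 1`): every coset in
`Γ \ ι(O(n₁ n₂))` is `Γ · α · β` with `α` the chosen representative of a coset of `Γ \ ι(O(n₁))` and
`β` the chosen representative of a coset of `Γ \ ι(O(n₂))` — factor a representative `ι(c)`,
`c = a b` (`exists_mul_eq_of_nrdZ_eq_mul`), and move the unit relating `ι(b)` to the chosen
representative of its coset over to `a`. [cite: Eichler1973, Ch. II §6 Thm. 2] -/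
theorem exists_mk_out_mul_out_eq (hD : 1 < D) (hM : 0 < M) {n₁ n₂ : ℕ} (hn₁ : 0 < n₁)
    (hn₂ : 0 < n₂) (hcop : n₁.Coprime n₂) (C : Quotient (X.heckeSetoid (n₁ * n₂))) :
    ∃ (A : Quotient (X.heckeSetoid n₁)) (B : Quotient (X.heckeSetoid n₂)),
      Quotient.mk (X.heckeSetoid (n₁ * n₂))
        ⟨((A.out : X.heckeSet n₁) : GL (Fin 2) ℝ) * ((B.out : X.heckeSet n₂) : GL (Fin 2) ℝ),
          X.mul_mem_heckeSet_mul A.out.2 B.out.2⟩ = C := by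
  obtain ⟨c, hc, hcC, hnc⟩ := X.exists_mem_O_ι_eq_of_mem_heckeSet (C.out : X.heckeSet (n₁ * n₂)).2
  obtain ⟨a, ha, b, hb, habc, hna, hnb⟩ :=
    X.exists_mul_eq_of_nrdZ_eq_mul hD hM hc hn₁ hn₂ hcop (by rw [hnc, Nat.cast_mul])
  obtain ⟨β₀, hβ₀⟩ := X.exists_heckeSet_coe_eq_ι hb hn₂ hnb
  obtain ⟨α₀, hα₀⟩ := X.exists_heckeSet_coe_eq_ι ha hn₁ hna
  set B : Quotient (X.heckeSetoid n₂) := Quotient.mk _ β₀ with hB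
  obtain ⟨δ, hδ, hδeq⟩ : (X.heckeSetoid n₂) β₀ B.out := Quotient.exact (by rw [Quotient.out_eq])
  have hα₁ : (α₀ : GL (Fin 2) ℝ) * δ⁻¹ ∈ X.heckeSet n₁ := X.mul_mem_heckeSet α₀.2 (inv_mem hδ)
  set A : Quotient (X.heckeSetoid n₁) := Quotient.mk _ ⟨_, hα₁⟩ with hA
  obtain ⟨ε, hε, hεeq⟩ : (X.heckeSetoid n₁) ⟨_, hα₁⟩ A.out := Quotient.exact (by rw [Quotient.out_eq])
  refine ⟨A, B, ?_⟩
  conv_rhs => rw [← Quotient.out_eq C]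
  refine Quotient.sound ⟨ε⁻¹, inv_mem hε, ?_⟩
  change ε⁻¹ * (((A.out : X.heckeSet n₁) : GL (Fin 2) ℝ) * ((B.out : X.heckeSet n₂) : GL (Fin 2) ℝ)) =
    ((C.out : X.heckeSet (n₁ * n₂)) : GL (Fin 2) ℝ)
  have hA' : ((A.out : X.heckeSet n₁) : GL (Fin 2) ℝ) = ε * ((α₀ : GL (Fin 2) ℝ) * δ⁻¹) := hεeq.symm
  have hB' : ((B.out : X.heckeSet n₂) : GL (Fin 2) ℝ) = δ * (β₀ : GL (Fin 2) ℝ) := hδeq.symm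
  rw [hA', hB']
  refine Units.ext ?_
  have : ε⁻¹ * (ε * ((α₀ : GL (Fin 2) ℝ) * δ⁻¹) * (δ * (β₀ : GL (Fin 2) ℝ))) =
      (α₀ : GL (Fin 2) ℝ) * (β₀ : GL (Fin 2) ℝ) := by group
  rw [this, Units.val_mul, hα₀, hβ₀, ← map_mul, habc, hcC]

/-- **Injectivity of `(Γα, Γβ) ↦ Γ α β_out`** (`gcd(n₁, n₂) = 1`, `n₂ ≥ 1`; any `D`): if
`Γ α β = Γ α' β'` for chosen representatives then the cosets agree — pull back to `O`, apply the
uniqueness of the factorisation (`exists_unit_of_mul_eq_mul`) to get `Γ β = Γ β'`, hence `β = β'`,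
and cancel. [cite: Eichler1973, Ch. II §6 Thm. 2] -/
theorem eq_of_mk_out_mul_out_eq {n₁ n₂ : ℕ} (hcop : n₁.Coprime n₂) (hn₂ : 0 < n₂)
    {A A' : Quotient (X.heckeSetoid n₁)} {B B' : Quotient (X.heckeSetoid n₂)}
    (h : Quotient.mk (X.heckeSetoid (n₁ * n₂))
        ⟨((A.out : X.heckeSet n₁) : GL (Fin 2) ℝ) * ((B.out : X.heckeSet n₂) : GL (Fin 2) ℝ),
          X.mul_mem_heckeSet_mul A.out.2 B.out.2⟩ =
      Quotient.mk (X.heckeSetoid (n₁ * n₂))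
        ⟨((A'.out : X.heckeSet n₁) : GL (Fin 2) ℝ) * ((B'.out : X.heckeSet n₂) : GL (Fin 2) ℝ),
          X.mul_mem_heckeSet_mul A'.out.2 B'.out.2⟩) :
    A = A' ∧ B = B' := by
  have hZ := X.isZOrder
  obtain ⟨ε, hε, hεeq⟩ := Quotient.exact h
  change ε * (((A.out : X.heckeSet n₁) : GL (Fin 2) ℝ) * ((B.out : X.heckeSet n₂) : GL (Fin 2) ℝ)) =
    ((A'.out : X.heckeSet n₁) : GL (Fin 2) ℝ) * ((B'.out : X.heckeSet n₂) : GL (Fin 2) ℝ) at hεeq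
  rw [← mul_assoc] at hεeq
  obtain ⟨a, ha, haA, -⟩ := X.exists_mem_O_ι_eq_of_mem_heckeSet (A.out : X.heckeSet n₁).2
  obtain ⟨a', ha', haA', hna'⟩ := X.exists_mem_O_ι_eq_of_mem_heckeSet (A'.out : X.heckeSet n₁).2
  obtain ⟨b, hb, hbB, hnb⟩ := X.exists_mem_O_ι_eq_of_mem_heckeSet (B.out : X.heckeSet n₂).2
  obtain ⟨b', hb', hbB', hnb'⟩ := X.exists_mem_O_ι_eq_of_mem_heckeSet (B'.out : X.heckeSet n₂).2
  obtain ⟨w, hw, hwε, -⟩ := X.exists_mem_O_ι_eq_of_mem_Gamma hε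
  have heqO : (w * a) * b = a' * b' := X.ι_injective (by
    rw [map_mul, map_mul, map_mul, hwε, haA, hbB, haA', hbB', ← Units.val_mul, ← Units.val_mul,
      ← Units.val_mul, hεeq])
  obtain ⟨u, hu, hnu, hub, -⟩ := X.exists_unit_of_mul_eq_mul (hZ.mul_mem _ hw _ ha) ha' hb hb'
    hcop hn₂.ne' hna' hnb hnb' heqO
  obtain ⟨γ, hγ, hγu⟩ := X.exists_mem_Gamma_coe_eq_ι_of_nrdZ_eq_one hu hnu
  have hBB' : B = B' := by
    rw [← Quotient.out_eq B, ← Quotient.out_eq B']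
    refine Quotient.sound ⟨γ, hγ, Units.ext ?_⟩
    rw [Units.val_mul, hγu, ← hbB, ← map_mul, hub, hbB']
  subst hBB'
  refine ⟨?_, rfl⟩
  rw [← Quotient.out_eq A, ← Quotient.out_eq A']
  exact Quotient.sound ⟨ε, hε, mul_right_cancel hεeq⟩

/-! ### 3. `T_{n₂} ∘ T_{n₁} = T_{n₁ n₂}` and `T_{n₁} T_{n₂} = T_{n₂} T_{n₁}` for coprime `n₁, n₂` -/

/-- **Multiplicativity of the Hecke operators of `X₀^D(M)` for coprime indices** (`D > 1`):
`T_{n₂} (T_{n₁} h) = T_{n₁ n₂} h` for every `Γ`-invariant `h` of weight `2` and `gcd(n₁, n₂) = 1`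
(Pasten §4.8 p. 15: the Hecke correspondences `T_{U,n}`; Shimura 1971 Thm. 3.24 (4)/(3.3.7) for
the modular case; for Eichler orders Eichler, LNM 320, II §6 Thm. 2 (18): unique factorisation of
ideals of coprime norms). Proof: `T_{n₂} T_{n₁} h = Σ_β Σ_α h ∣ (α β)` over chosen representatives,
and `(Γα, Γβ) ↦ Γ α β` is a bijection onto `Γ \ ι(O(n₁ n₂))` (`exists_mk_out_mul_out_eq`,
`eq_of_mk_out_mul_out_eq`); `h ∣ (α β) = h ∣ (Γ α β)_out` by `Γ`-invariance. The cases `n₁ = 0`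
or `n₂ = 0` are `T_0 = 0`. [cite: PastenShimura2024, §4.8 p. 15 (Hecke action)] [cite: Eichler1973, Ch. II §6 Thm. 2 (18)] -/
theorem heckeFun_heckeFun_of_coprime (hD : 1 < D) (hM : 0 < M) {n₁ n₂ : ℕ} (hcop : n₁.Coprime n₂)
    (h : ℍ → ℂ) (hh : ∀ δ ∈ X.Gamma, h ∣[(2 : ℤ)] δ = h) :
    X.heckeFun n₂ (X.heckeFun n₁ h) = X.heckeFun (n₁ * n₂) h := by
  classical
  rcases Nat.eq_zero_or_pos n₁ with rfl | hn₁
  · rw [X.heckeFun_zero_left, X.heckeFun_zero, zero_mul, X.heckeFun_zero_left]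
  rcases Nat.eq_zero_or_pos n₂ with rfl | hn₂
  · rw [X.heckeFun_zero_left, mul_zero, X.heckeFun_zero_left]
  haveI := X.finite_quotient_heckeSetoid hD n₁
  haveI := X.finite_quotient_heckeSetoid hD n₂
  haveI := X.finite_quotient_heckeSetoid hD (n₁ * n₂)
  letI : Fintype (Quotient (X.heckeSetoid n₁)) := Fintype.ofFinite _
  letI : Fintype (Quotient (X.heckeSetoid n₂)) := Fintype.ofFinite _
  letI : Fintype (Quotient (X.heckeSetoid (n₁ * n₂))) := Fintype.ofFinite _
  -- the bijection `(Γα, Γβ) ↦ Γ α β_out`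
  let Ψ : Quotient (X.heckeSetoid n₁) × Quotient (X.heckeSetoid n₂) →
      Quotient (X.heckeSetoid (n₁ * n₂)) := fun p =>
    Quotient.mk (X.heckeSetoid (n₁ * n₂))
      ⟨((p.1.out : X.heckeSet n₁) : GL (Fin 2) ℝ) * ((p.2.out : X.heckeSet n₂) : GL (Fin 2) ℝ),
        X.mul_mem_heckeSet_mul p.1.out.2 p.2.out.2⟩
  have hΨ : Function.Bijective Ψ := by
    refine ⟨fun p q hpq => ?_, fun C => ?_⟩
    · obtain ⟨h1, h2⟩ := X.eq_of_mk_out_mul_out_eq hcop hn₂ hpq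
      exact Prod.ext h1 h2
    · obtain ⟨A, B, hAB⟩ := X.exists_mk_out_mul_out_eq hD hM hn₁ hn₂ hcop C
      exact ⟨(A, B), hAB⟩
  let e := Equiv.ofBijective Ψ hΨ
  -- termwise: `h ∣ α ∣ β = h ∣ (Γ α β)_out`
  have hterm : ∀ p : Quotient (X.heckeSetoid n₁) × Quotient (X.heckeSetoid n₂),
      (h ∣[(2 : ℤ)] ((p.1.out : X.heckeSet n₁) : GL (Fin 2) ℝ)) ∣[(2 : ℤ)]
          ((p.2.out : X.heckeSet n₂) : GL (Fin 2) ℝ) =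
        h ∣[(2 : ℤ)] (((e p).out : X.heckeSet (n₁ * n₂)) : GL (Fin 2) ℝ) := by
    intro p
    obtain ⟨δ, hδ, hδeq⟩ : (X.heckeSetoid (n₁ * n₂))
        ⟨((p.1.out : X.heckeSet n₁) : GL (Fin 2) ℝ) * ((p.2.out : X.heckeSet n₂) : GL (Fin 2) ℝ),
          X.mul_mem_heckeSet_mul p.1.out.2 p.2.out.2⟩ (e p).out :=
      Quotient.exact (by rw [Quotient.out_eq]; rfl)
    change δ * (((p.1.out : X.heckeSet n₁) : GL (Fin 2) ℝ) * ((p.2.out : X.heckeSet n₂) : GL (Fin 2) ℝ)) =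
      (((e p).out : X.heckeSet (n₁ * n₂)) : GL (Fin 2) ℝ) at hδeq
    rw [← hδeq, SlashAction.slash_mul, SlashAction.slash_mul, hh δ hδ]
  rw [X.heckeFun_eq_sum n₂, X.heckeFun_eq_sum n₁, X.heckeFun_eq_sum (n₁ * n₂)]
  simp_rw [SlashAction.sum_slash]
  rw [← Fintype.sum_prod_type_right' fun (A : Quotient (X.heckeSetoid n₁))
    (B : Quotient (X.heckeSetoid n₂)) =>
      (h ∣[(2 : ℤ)] ((A.out : X.heckeSet n₁) : GL (Fin 2) ℝ)) ∣[(2 : ℤ)] ((B.out : X.heckeSet n₂) : GL (Fin 2) ℝ)]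
  simp_rw [hterm]
  exact e.sum_comp (fun C => h ∣[(2 : ℤ)] ((C.out : X.heckeSet (n₁ * n₂)) : GL (Fin 2) ℝ))

/-- **The Hecke operators of `X₀^D(M)` with coprime indices commute** (`D > 1`):
`T_{n₂} (T_{n₁} h) = T_{n₁} (T_{n₂} h)` for `Γ`-invariant `h` of weight `2`, `gcd(n₁, n₂) = 1` — both
sides are `T_{n₁ n₂} h` (Pasten §4.9 p. 15: the Hecke algebra `T_{D,M}` generated by the `T_{D,M,n}`
is commutative; Shimura 1971 Thm. 3.34/Prop. 3.8). [cite: PastenShimura2024, §4.9 p. 15 (the Hecke algebra)] [cite: Eichler1973, Ch. II §6 Thm. 2 (18)] -/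
theorem heckeFun_comm_of_coprime (hD : 1 < D) (hM : 0 < M) {n₁ n₂ : ℕ} (hcop : n₁.Coprime n₂)
    (h : ℍ → ℂ) (hh : ∀ δ ∈ X.Gamma, h ∣[(2 : ℤ)] δ = h) :
    X.heckeFun n₂ (X.heckeFun n₁ h) = X.heckeFun n₁ (X.heckeFun n₂ h) := by
  rw [X.heckeFun_heckeFun_of_coprime hD hM hcop h hh,
    X.heckeFun_heckeFun_of_coprime hD hM hcop.symm h hh, mul_comm]


/-! ### 4. The endomorphisms `T_{D,M,n}` of `S₂^D(M)` compose multiplicatively and commute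
(coprime indices) -/

/-- **`T_{n₂} ∘ T_{n₁} = T_{n₁ n₂}` in `End_ℂ(S₂^D(M))`** for coprime `n₁, n₂` (`D > 1`), for the
endomorphisms of `exists_linearMap_coe_eq_heckeFun` (`⇑(T g) = T_n g`). [cite: PastenShimura2024, §4.8 p. 15 (Hecke action)] [cite: Eichler1973, Ch. II §6 Thm. 2 (18)] -/
theorem linearMap_comp_eq_of_coprime (hD : 1 < D) (hM : 0 < M) {n₁ n₂ : ℕ} (hcop : n₁.Coprime n₂)
    {T₁ T₂ T₁₂ : CuspForm X.Gamma 2 →ₗ[ℂ] CuspForm X.Gamma 2}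
    (hT₁ : ∀ g : CuspForm X.Gamma 2, (⇑(T₁ g) : ℍ → ℂ) = X.heckeFun n₁ g)
    (hT₂ : ∀ g : CuspForm X.Gamma 2, (⇑(T₂ g) : ℍ → ℂ) = X.heckeFun n₂ g)
    (hT₁₂ : ∀ g : CuspForm X.Gamma 2, (⇑(T₁₂ g) : ℍ → ℂ) = X.heckeFun (n₁ * n₂) g) :
    T₂ ∘ₗ T₁ = T₁₂ :=
  LinearMap.ext fun g => DFunLike.coe_injective (by
    rw [LinearMap.comp_apply, hT₂, hT₁, hT₁₂]
    exact X.heckeFun_heckeFun_of_coprime hD hM hcop g fun δ hδ =>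
      SlashInvariantForm.slash_action_eqn g δ hδ)

/-- **The endomorphisms `T_{D,M,n₁}`, `T_{D,M,n₂}` of `S₂^D(M)` commute** for coprime `n₁, n₂`
(`D > 1`; Pasten §4.9 p. 15: `T_{D,M}` is a commutative algebra). [cite: PastenShimura2024, §4.9 p. 15 (the Hecke algebra)] [cite: Eichler1973, Ch. II §6 Thm. 2 (18)] -/
theorem commute_linearMap_of_coprime (hD : 1 < D) (hM : 0 < M) {n₁ n₂ : ℕ} (hcop : n₁.Coprime n₂)
    {T₁ T₂ : CuspForm X.Gamma 2 →ₗ[ℂ] CuspForm X.Gamma 2}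
    (hT₁ : ∀ g : CuspForm X.Gamma 2, (⇑(T₁ g) : ℍ → ℂ) = X.heckeFun n₁ g)
    (hT₂ : ∀ g : CuspForm X.Gamma 2, (⇑(T₂ g) : ℍ → ℂ) = X.heckeFun n₂ g) :
    Commute T₁ T₂ := by
  refine LinearMap.ext fun g => DFunLike.coe_injective ?_
  change (⇑(T₁ (T₂ g)) : ℍ → ℂ) = ⇑(T₂ (T₁ g))
  rw [hT₁, hT₂, hT₂, hT₁]
  exact (X.heckeFun_comm_of_coprime hD hM hcop g fun δ hδ =>
    SlashInvariantForm.slash_action_eqn g δ hδ).symm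

end ShimuraCurveData

end Literature.NumberTheory.Automorphic

end
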